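import Summits.ValiantsHypothesis.ValiantsHypothesis.Theorems.LacunarySymmetroidMatrixDescartesCensusChamberSignClass
import Summits.ValiantsHypothesis.ValiantsHypothesis.Theorems.LacunarySymmetroidMatrixDescartesCensusNewtonCone

/-!
# `MatrixDescartes` census — CHAMBER-UNIFORM Newton-cone rows (C25) and coefficient dictionary for a symbolic support

HONEST FRAMING.  Object-search cell `pub-symmetroid`, door-A target `DoorA26 := PosRootLawAt 2 6 19`
(stmt-ValiantsHypothesis-19979; OPEN, typed, never asserted), crux `Theses.LacunarySymmetroid.MatrixDescartes`
(stmt-ValiantsHypothesis-18050).  Every magnitude-level certificate of the cell against `V = 20` (T-NC-LP-CERT, BOX20,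
the uniform rays) uses the rows C25 = `Census.newton_cone*` together with the coefficient dictionary; in the kernel they
have been instantiated support by support (`tnc_rows_<d>`, numeral exponents, numeral gap products `W_t`).  A chamber
cover of door A (`Census.doorA26_iff_forall_chamberOrder`) needs them for a SYMBOLIC exponent vector `d` ranging over a
chamber (order `σ` of the 21 pairs, hypothesis `StrictMono ((fun p => d p.1 + d p.2) ∘ σ)`).  This file supplies exactly
that, once:

* `coeff_det_diag_of_chamber`, `coeff_det_pair_of_chamber` — for a pair listed by `σ` the coefficient of `det F` at its
  sum is the atom `q_i = det S_i`, resp. `β_ij = 2B(S_i,S_j)`, in entry coordinates (uniqueness of the sum from the order);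
* `support_det_of_chamber_sharp` — with `20` distinct positive roots the support of `det F` is the image of the listed
  sums `E t = d (σ t).1 + d (σ t).2` (`t : Fin 21`), and `coeff_det_ne_zero_of_chamber_sharp`;
* **`chamber_newton_cone`** — for every triple of positions `p < q < r` the C25 inequality
  `A_p^{E r − E q} · A_r^{E q − E p} ≤ A_q^{E r − E p}` with `A_t = |coeff (E t)| · ∏_{s ≠ t} |E t − E s|`, all exponents and
  gap products SYMBOLIC linear forms / products of linear forms in `d`; and its logarithmic form
  `chamber_newton_cone_log` (concavity of `t ↦ (E t, log A_t)`), the shape the slope-form certificates of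
  UNIFORM-NC-SLOPE-g6 consume.

No certificate is replayed here and no row of any table is claimed; nothing bears on `V = 19`, on `DoorA26` (OPEN), on
the crux, or on `VP ≠ VNP`.

[folklore] Bookkeeping over the tree's C25 theorem (`newton_cone_det_pencil`); elementary.
-/

-- `Summit.ValiantsHypothesis.ValiantsHypothesis.…` repeats a component by the D-0017 layout
-- (single-conjunct summit), which the `dupNamespace` linter flags; the name is mandated.
set_option linter.dupNamespace false

namespace Summit.ValiantsHypothesis.ValiantsHypothesis.Theorems.LacunarySymmetroidMatrixDescartes.Census

open Polynomial Finset
open scoped BigOperators Polynomial Matrix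

/-! ## The coefficient dictionary along a chamber order -/

/-- In a chamber a DIAGONAL pair listed by `σ` is the only pair with its sum. [folklore] -/
theorem pair_unique_diag_of_chamber (σ : Fin 21 → Fin 6 × Fin 6)
    (hcov : ∀ p : Fin 6 × Fin 6, ∃ t : Fin 21, σ t = p ∨ σ t = p.swap) (d : Fin 6 → ℕ)
    (hd : StrictMono ((fun p : Fin 6 × Fin 6 => d p.1 + d p.2) ∘ σ)) {t : Fin 21} {i : Fin 6} (ht : σ t = (i, i)) :
    ∀ p : Fin 6 × Fin 6, d p.1 + d p.2 = d i + d i → p = (i, i) := by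
  intro p hp
  have hp' : d p.1 + d p.2 = d (σ t).1 + d (σ t).2 := by rw [ht]; exact hp
  rcases pair_eq_of_chamber σ hcov d hd t p hp' with h | h
  · rw [h, ht]
  · rw [h, ht]; rfl

/-- In a chamber a MIXED pair listed by `σ` is, up to swap, the only pair with its sum. [folklore] -/
theorem pair_unique_of_chamber (σ : Fin 21 → Fin 6 × Fin 6)
    (hcov : ∀ p : Fin 6 × Fin 6, ∃ t : Fin 21, σ t = p ∨ σ t = p.swap) (d : Fin 6 → ℕ)
    (hd : StrictMono ((fun p : Fin 6 × Fin 6 => d p.1 + d p.2) ∘ σ)) {t : Fin 21} {i j : Fin 6} (ht : σ t = (i, j)) :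
    ∀ p : Fin 6 × Fin 6, d p.1 + d p.2 = d i + d j → p = (i, j) ∨ p = (j, i) := by
  intro p hp
  have hp' : d p.1 + d p.2 = d (σ t).1 + d (σ t).2 := by rw [ht]; exact hp
  rcases pair_eq_of_chamber σ hcov d hd t p hp' with h | h
  · left; rw [h, ht]
  · right; rw [h, ht]; rfl

/-- **Dictionary, diagonal letter**: in a chamber, the coefficient of `det F` at a listed diagonal sum `2 d_i` is
`q_i = det S_i` (entry coordinates, `S_i` symmetric). [folklore] -/
theorem coeff_det_diag_of_chamber (σ : Fin 21 → Fin 6 × Fin 6)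
    (hcov : ∀ p : Fin 6 × Fin 6, ∃ t : Fin 21, σ t = p ∨ σ t = p.swap) (d : Fin 6 → ℕ)
    (hd : StrictMono ((fun p : Fin 6 × Fin 6 => d p.1 + d p.2) ∘ σ))
    (S : Fin 6 → Matrix (Fin 2) (Fin 2) ℝ) (hS : ∀ l, (S l).IsSymm) {t : Fin 21} {i : Fin 6} (ht : σ t = (i, i)) :
    (∑ l, ((X : ℝ[X]) ^ d l) • (S l).map C).det.coeff (d i + d i) = S i 0 0 * S i 1 1 - S i 0 1 ^ 2 := by
  have hsym : S i 1 0 = S i 0 1 := by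
    have h := congrFun (congrFun (hS i) 1) 0
    simp only [Matrix.transpose_apply] at h
    exact h.symm
  rw [coeff_det_pencil_two_diag d S i (pair_unique_diag_of_chamber σ hcov d hd ht), hsym, sq]

/-- **Dictionary, mixed letter**: in a chamber, the coefficient of `det F` at a listed mixed sum `d_i + d_j` (`i ≠ j`) is
`β_ij = 2B(S_i,S_j) = S_i₀₀S_j₁₁ + S_i₁₁S_j₀₀ − 2S_i₀₁S_j₀₁`. [folklore] -/
theorem coeff_det_pair_of_chamber (σ : Fin 21 → Fin 6 × Fin 6)
    (hcov : ∀ p : Fin 6 × Fin 6, ∃ t : Fin 21, σ t = p ∨ σ t = p.swap) (d : Fin 6 → ℕ)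
    (hd : StrictMono ((fun p : Fin 6 × Fin 6 => d p.1 + d p.2) ∘ σ))
    (S : Fin 6 → Matrix (Fin 2) (Fin 2) ℝ) (hS : ∀ l, (S l).IsSymm) {t : Fin 21} {i j : Fin 6} (ht : σ t = (i, j))
    (hij : i ≠ j) :
    (∑ l, ((X : ℝ[X]) ^ d l) • (S l).map C).det.coeff (d i + d j)
      = S i 0 0 * S j 1 1 + S i 1 1 * S j 0 0 - 2 * (S i 0 1 * S j 0 1) := by
  have hsym : ∀ l, S l 1 0 = S l 0 1 := fun l => by
    have h := congrFun (congrFun (hS l) 1) 0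
    simp only [Matrix.transpose_apply] at h
    exact h.symm
  rw [coeff_det_pencil_two_pair d S hij (pair_unique_of_chamber σ hcov d hd ht), hsym, hsym]; ring

/-! ## Support and non-vanishing under sharpness -/

/-- **Sharp support in a chamber**: with `20` distinct positive roots, `supp (det F)` is the set of the 21 listed sums. [folklore] -/
theorem support_det_of_chamber_sharp (σ : Fin 21 → Fin 6 × Fin 6)
    (hcov : ∀ p : Fin 6 × Fin 6, ∃ t : Fin 21, σ t = p ∨ σ t = p.swap) (d : Fin 6 → ℕ)
    (hd : StrictMono ((fun p : Fin 6 × Fin 6 => d p.1 + d p.2) ∘ σ))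
    (S : Fin 6 → Matrix (Fin 2) (Fin 2) ℝ)
    (hZ : 20 ≤ ((∑ l, ((X : ℝ[X]) ^ d l) • (S l).map C).det.roots.toFinset.filter (fun t => 0 < t)).card) :
    (∑ l, ((X : ℝ[X]) ^ d l) • (S l).map C).det.support
      = (univ : Finset (Fin 21)).image (fun t => d (σ t).1 + d (σ t).2) := by
  set P := (∑ l, ((X : ℝ[X]) ^ d l) • (S l).map C).det with hP_def
  have hN : ((univ : Finset (Fin 6 × Fin 6)).image (fun p => d p.1 + d p.2)).card = 21 :=
    card_pairSums_of_chamber σ hcov d hd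
  have hP : P ≠ 0 := by
    intro hP0
    have : (P.roots.toFinset.filter (fun t => 0 < t)).card = 0 := by rw [hP0]; simp
    omega
  have hZW : ((univ : Finset (Fin 2 → Fin 6)).image (fun g => ∑ i, d (g i))).card
      ≤ (P.roots.toFinset.filter (fun t => 0 < t)).card + 1 := by
    rw [sumset_two_eq_pairSums, hN]; omega
  rw [hP_def, support_det_pencil_eq_sumset_of_sharp d S hP hZW, sumset_two_eq_pairSums,
    image_pairSum_eq_of_chamber σ hcov d]

/-- With `20` distinct positive roots every listed coefficient is non-zero. [folklore] -/
theorem coeff_det_ne_zero_of_chamber_sharp (σ : Fin 21 → Fin 6 × Fin 6)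
    (hcov : ∀ p : Fin 6 × Fin 6, ∃ t : Fin 21, σ t = p ∨ σ t = p.swap) (d : Fin 6 → ℕ)
    (hd : StrictMono ((fun p : Fin 6 × Fin 6 => d p.1 + d p.2) ∘ σ))
    (S : Fin 6 → Matrix (Fin 2) (Fin 2) ℝ)
    (hZ : 20 ≤ ((∑ l, ((X : ℝ[X]) ^ d l) • (S l).map C).det.roots.toFinset.filter (fun t => 0 < t)).card)
    (t : Fin 21) : (∑ l, ((X : ℝ[X]) ^ d l) • (S l).map C).det.coeff (d (σ t).1 + d (σ t).2) ≠ 0 := by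
  have hmem : d (σ t).1 + d (σ t).2 ∈ (∑ l, ((X : ℝ[X]) ^ d l) • (S l).map C).det.support := by
    rw [support_det_of_chamber_sharp σ hcov d hd S hZ]
    exact mem_image.mpr ⟨t, mem_univ _, rfl⟩
  exact mem_support_iff.mp hmem

/-! ## C25 along the chamber order -/

/-- **CHAMBER-UNIFORM NEWTON CONE (C25).**  Let `d` lie in the chamber of the covering order `σ`, put
`E t := d (σ t).1 + d (σ t).2` (strictly increasing in `t`), and let a real symmetric `2 × 2` pencil on `d` have `20`
distinct positive det-roots.  Then for all positions `p < q < r`, with `A_t := |coeff (det F) (E t)| · ∏_{s ≠ t} |E t − E s|`: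
`A_p^{E r − E q} · A_r^{E q − E p} ≤ A_q^{E r − E p}` — exponents and gap products being SYMBOLIC in `d`.  (Instance of the
tree's `newton_cone_det_pencil`, with the sharp support rewritten as the image of `E`.) [folklore] -/
theorem chamber_newton_cone (σ : Fin 21 → Fin 6 × Fin 6)
    (hcov : ∀ p : Fin 6 × Fin 6, ∃ t : Fin 21, σ t = p ∨ σ t = p.swap) (d : Fin 6 → ℕ)
    (hd : StrictMono ((fun p : Fin 6 × Fin 6 => d p.1 + d p.2) ∘ σ))
    (S : Fin 6 → Matrix (Fin 2) (Fin 2) ℝ)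
    (hZ : 20 ≤ ((∑ l, ((X : ℝ[X]) ^ d l) • (S l).map C).det.roots.toFinset.filter (fun t => 0 < t)).card)
    {p q r : Fin 21} (hpq : p < q) (hqr : q < r) :
    (|(∑ l, ((X : ℝ[X]) ^ d l) • (S l).map C).det.coeff (d (σ p).1 + d (σ p).2)| *
        ∏ s ∈ univ.erase p, |((d (σ p).1 + d (σ p).2 : ℕ) : ℝ) - ((d (σ s).1 + d (σ s).2 : ℕ) : ℝ)|) ^
        ((d (σ r).1 + d (σ r).2) - (d (σ q).1 + d (σ q).2)) *
      (|(∑ l, ((X : ℝ[X]) ^ d l) • (S l).map C).det.coeff (d (σ r).1 + d (σ r).2)| *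
        ∏ s ∈ univ.erase r, |((d (σ r).1 + d (σ r).2 : ℕ) : ℝ) - ((d (σ s).1 + d (σ s).2 : ℕ) : ℝ)|) ^
        ((d (σ q).1 + d (σ q).2) - (d (σ p).1 + d (σ p).2))
      ≤ (|(∑ l, ((X : ℝ[X]) ^ d l) • (S l).map C).det.coeff (d (σ q).1 + d (σ q).2)| *
        ∏ s ∈ univ.erase q, |((d (σ q).1 + d (σ q).2 : ℕ) : ℝ) - ((d (σ s).1 + d (σ s).2 : ℕ) : ℝ)|) ^
        ((d (σ r).1 + d (σ r).2) - (d (σ p).1 + d (σ p).2)) := by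
  classical
  set P := (∑ l, ((X : ℝ[X]) ^ d l) • (S l).map C).det with hP_def
  set E : Fin 21 → ℕ := fun t => d (σ t).1 + d (σ t).2 with hE
  have hEinj : Function.Injective E := hd.injective
  have hN : ((univ : Finset (Fin 6 × Fin 6)).image (fun p => d p.1 + d p.2)).card = 21 :=
    card_pairSums_of_chamber σ hcov d hd
  have hsupp : P.support = (univ : Finset (Fin 21)).image E := support_det_of_chamber_sharp σ hcov d hd S hZ
  have hZW : ((univ : Finset (Fin 2 → Fin 6)).image (fun g => ∑ i, d (g i))).card
      ≤ (P.roots.toFinset.filter (fun t => 0 < t)).card + 1 := by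
    rw [sumset_two_eq_pairSums, hN]; omega
  have hmem : ∀ t : Fin 21, E t ∈ P.support := fun t => by
    rw [hsupp]; exact mem_image.mpr ⟨t, mem_univ _, rfl⟩
  have key := newton_cone_det_pencil d S hZW (hmem p) (hmem q) (hmem r) (hd hpq) (hd hqr)
  dsimp only at key
  rw [← hP_def] at key
  -- rewrite the gap products over the support as products over positions
  have hprod : ∀ t : Fin 21, ∏ u ∈ P.support.erase (E t), |((E t : ℕ) : ℝ) - (u : ℝ)|
      = ∏ s ∈ univ.erase t, |((E t : ℕ) : ℝ) - ((E s : ℕ) : ℝ)| := by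
    intro t
    rw [hsupp, ← image_erase hEinj, prod_image (fun x _ y _ h => hEinj h)]
  rw [hprod p, hprod q, hprod r] at key
  exact key

/-- **C25, logarithmic form along the chamber order**: with `a_t := log A_t`, for all `p < q < r`,
`(E r − E q)·a_p + (E q − E p)·a_r ≤ (E r − E p)·a_q` — the points `(E t, a_t)` are in concave position; exponent
differences are cast to `ℝ` (honest subtraction, `E` increasing). [folklore] -/
theorem chamber_newton_cone_log (σ : Fin 21 → Fin 6 × Fin 6)
    (hcov : ∀ p : Fin 6 × Fin 6, ∃ t : Fin 21, σ t = p ∨ σ t = p.swap) (d : Fin 6 → ℕ)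
    (hd : StrictMono ((fun p : Fin 6 × Fin 6 => d p.1 + d p.2) ∘ σ))
    (S : Fin 6 → Matrix (Fin 2) (Fin 2) ℝ)
    (hZ : 20 ≤ ((∑ l, ((X : ℝ[X]) ^ d l) • (S l).map C).det.roots.toFinset.filter (fun t => 0 < t)).card)
    {p q r : Fin 21} (hpq : p < q) (hqr : q < r) :
    (((d (σ r).1 + d (σ r).2 : ℕ) : ℝ) - ((d (σ q).1 + d (σ q).2 : ℕ) : ℝ)) *
        Real.log (|(∑ l, ((X : ℝ[X]) ^ d l) • (S l).map C).det.coeff (d (σ p).1 + d (σ p).2)| *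
          ∏ s ∈ univ.erase p, |((d (σ p).1 + d (σ p).2 : ℕ) : ℝ) - ((d (σ s).1 + d (σ s).2 : ℕ) : ℝ)|) +
      (((d (σ q).1 + d (σ q).2 : ℕ) : ℝ) - ((d (σ p).1 + d (σ p).2 : ℕ) : ℝ)) *
        Real.log (|(∑ l, ((X : ℝ[X]) ^ d l) • (S l).map C).det.coeff (d (σ r).1 + d (σ r).2)| *
          ∏ s ∈ univ.erase r, |((d (σ r).1 + d (σ r).2 : ℕ) : ℝ) - ((d (σ s).1 + d (σ s).2 : ℕ) : ℝ)|)
      ≤ (((d (σ r).1 + d (σ r).2 : ℕ) : ℝ) - ((d (σ p).1 + d (σ p).2 : ℕ) : ℝ)) *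
        Real.log (|(∑ l, ((X : ℝ[X]) ^ d l) • (S l).map C).det.coeff (d (σ q).1 + d (σ q).2)| *
          ∏ s ∈ univ.erase q, |((d (σ q).1 + d (σ q).2 : ℕ) : ℝ) - ((d (σ s).1 + d (σ s).2 : ℕ) : ℝ)|) := by
  classical
  set P := (∑ l, ((X : ℝ[X]) ^ d l) • (S l).map C).det with hP_def
  set E : Fin 21 → ℕ := fun t => d (σ t).1 + d (σ t).2 with hE
  have h := chamber_newton_cone σ hcov d hd S hZ hpq hqr
  have hEinj : Function.Injective E := hd.injective
  have hpos : ∀ t : Fin 21, 0 < |P.coeff (E t)| * ∏ s ∈ univ.erase t, |((E t : ℕ) : ℝ) - ((E s : ℕ) : ℝ)| := by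
    intro t
    apply mul_pos (abs_pos.mpr (coeff_det_ne_zero_of_chamber_sharp σ hcov d hd S hZ t))
    apply prod_pos
    intro s hs
    apply abs_pos.mpr
    intro h0
    have : (E t : ℝ) = (E s : ℝ) := by linarith
    have hst : s = t := hEinj (by exact_mod_cast this.symm)
    exact ne_of_mem_erase hs hst
  have hlog := Real.log_le_log (by have := hpos p; have := hpos r; positivity) h
  rw [Real.log_mul (pow_ne_zero _ (hpos p).ne') (pow_ne_zero _ (hpos r).ne'), Real.log_pow, Real.log_pow,
    Real.log_pow] at hlog
  have hepq : E p ≤ E q := (hd hpq).le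
  have heqr : E q ≤ E r := (hd hqr).le
  have hepr : E p ≤ E r := hepq.trans heqr
  have e1 : (((E r - E q : ℕ) : ℝ)) = (E r : ℝ) - (E q : ℝ) := by push_cast [Nat.cast_sub heqr]; ring
  have e2 : (((E q - E p : ℕ) : ℝ)) = (E q : ℝ) - (E p : ℝ) := by push_cast [Nat.cast_sub hepq]; ring
  have e3 : (((E r - E p : ℕ) : ℝ)) = (E r : ℝ) - (E p : ℝ) := by push_cast [Nat.cast_sub hepr]; ring
  rw [e1, e2, e3] at hlog
  simpa [hE] using hlog

end Summit.ValiantsHypothesis.ValiantsHypothesis.Theorems.LacunarySymmetroidMatrixDescartes.Census
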